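import Mathlib.Tactic.NoncommRing
import Mathlib.Tactic.Ring
import Mathlib.Tactic.LinearCombination

/-!
# Weil-type family coverage — the algebraic core of THEOREM U (uniform discriminant law) (ring2-b02, gen 58)

research route conditional on HC_CM; not a corollary; Q11.4-sentence-2 already refuted in dim ≥ 3.

Ring 2, WEIL-TYPE FAMILY-COVERAGE CENSUS (`HOME/WEIL-FAMILY-COVERAGE.md` `## b02 (g = 6)`, block b02.18 «THEOREM U»,
owner ring2-b02).  Setting of b02.16–b02.18 / b04.10 / b05.17: a finite quaternion group `G ⊂ D^×` (`Dic_n`, `2T`,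
`2O`, `2I`; `D` a totally definite quaternion algebra with totally real centre `F`), a `G`-cover `C̃ → C` with branch
monodromies `c₁, …, c_N`, the `D`-part `V` of `H₁(C̃; ℚ)` with its cup form.  THEOREM U (seat-derived in the census
file) says that the reduced norm of the Gram matrix of the cup form on `V` is `∏ⱼ Nrd_D(1 - cⱼ) = ∏ⱼ (2 - Trd cⱼ)`
modulo squares of totally positive elements of `F`; its proof rests on two IDENTITIES IN THE QUATERNION ALGEBRA that
hold verbatim in every ring — they are what this file certifies:

* §1 `UniformDiscriminant.rankOne_gram`: with `κ(c) = (1 + c)(1 - c)⁻¹` the Cayley transform, the rank-one Gram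
  element `κ(c₁) + κ(c₂)` of a three-point datum equals `2 · (1 - c₁)⁻¹ (1 - c₁ c₂) (1 - c₂)⁻¹` (b02.18 (P3)), so its
  reduced norm is `4 · Nrd(1 - c₁c₂) / (Nrd(1 - c₁) Nrd(1 - c₂))`;
* §2 `UniformDiscriminant.lu_step`: the non-commutative identity
  `(1 - Q x)(1 - x)⁻¹(1 - x y) - (1 - Q) x (1 - x)⁻¹ (1 - y) = 1 - Q x y` driving the LU induction of b02.18 (P4)
  (pivots `d_a = 2 (1 - P_a)⁻¹ (1 - P_{a+1}) (1 - c_{a+1})⁻¹`, closed form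
  `Nrd(Gram) = 4^{N-2} · Nrd(1 - c_N) / ∏_{j<N} Nrd(1 - c_j)`);
* §3 the label arithmetic behind the per-class weights `2 - Trd c` used by the census (`F = ℚ(√2)`, `ℚ(φ)`):
  `(2 - s)(2 + s) = 2` for `s² = 2`; `(3 - φ)(2 + φ) = 5`, `2 - φ = (φ - 1)²`, `1 + φ = φ²` for `φ² = φ + 1`.

Inverses are carried as explicit two-sided inverses (`(1 - c) * i = 1`, `i * (1 - c) = 1`), so every statement is an
identity in an arbitrary (non-commutative) ring.  No `def`, no named fact, no `sorry`; nothing here is a statement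
about Hodge classes; `HC_CM` is used nowhere.
-/

set_option linter.dupNamespace false

namespace Summit.HodgeConjecture.HodgeConjecture.Ring2.WeilCoverage.UniformDiscriminant

section NonCommutative

variable {R : Type*} [Ring R]

/-! ### §0 Two-sided inverses of `1 - x` commute with `x` -/

/-- If `i` is a two-sided inverse of `1 - x` then `x * i = i - 1`. -/
theorem mul_inv_oneSub_eq {x i : R} (h : (1 - x) * i = 1) : x * i = i - 1 := by
  have e : i - x * i = 1 := by
    have : (1 - x) * i = i - x * i := by noncomm_ring
    rw [this] at h; exact h
  calc x * i = i - (i - x * i) := by noncomm_ring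
    _ = i - 1 := by rw [e]

/-- If `i` is a two-sided inverse of `1 - x` then `i * x = i - 1`. -/
theorem inv_oneSub_mul_eq {x i : R} (h' : i * (1 - x) = 1) : i * x = i - 1 := by
  have e : i - i * x = 1 := by
    have : i * (1 - x) = i - i * x := by noncomm_ring
    rw [this] at h'; exact h'
  calc i * x = i - (i - i * x) := by noncomm_ring
    _ = i - 1 := by rw [e]

/-- `x` commutes with the inverse of `1 - x` (the Cayley transform `(1 + x)(1 - x)⁻¹` is unambiguous). -/
theorem comm_inv_oneSub {x i : R} (h : (1 - x) * i = 1) (h' : i * (1 - x) = 1) : x * i = i * x := by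
  rw [mul_inv_oneSub_eq h, inv_oneSub_mul_eq h']

/-! ### §1 The rank-one Gram element (b02.18 (P3)) -/

/-- The numerator identity `(1 + c₁)(1 - c₂) + (1 - c₁)(1 + c₂) = 2 (1 - c₁ c₂)` (any ring). -/
theorem cayley_numerator (c₁ c₂ : R) :
    (1 + c₁) * (1 - c₂) + (1 - c₁) * (1 + c₂) = 2 * (1 - c₁ * c₂) := by
  noncomm_ring

/-- **Rank-one Gram element of a three-point datum** (b02.18 (P3)): if `i₁`, `i₂` are two-sided inverses of
`1 - c₁`, `1 - c₂`, then the sum of the Cayley transforms is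
`(1 + c₁) i₁ + (1 + c₂) i₂ = 2 · i₁ (1 - c₁ c₂) i₂`.  In the quaternion algebra this gives
`Nrd(κ₁ + κ₂) = 4 · Nrd(1 - c₁c₂) / (Nrd(1 - c₁) · Nrd(1 - c₂))`, i.e. `≡ ∏_{j=1}^{3} Nrd(1 - c_j)` modulo squares of
totally positive elements (`c₃ = (c₁c₂)⁻¹`). -/
theorem rankOne_gram (c₁ c₂ i₁ i₂ : R) (h₁ : (1 - c₁) * i₁ = 1) (h₁' : i₁ * (1 - c₁) = 1)
    (h₂ : (1 - c₂) * i₂ = 1) :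
    (1 + c₁) * i₁ + (1 + c₂) * i₂ = 2 * (i₁ * (1 - c₁ * c₂) * i₂) := by
  have hc : c₁ * i₁ = i₁ * c₁ := comm_inv_oneSub h₁ h₁'
  -- move `i₁` to the left of `1 + c₁`
  have e₁ : (1 + c₁) * i₁ = i₁ * (1 + c₁) := by
    calc (1 + c₁) * i₁ = i₁ + c₁ * i₁ := by noncomm_ring
      _ = i₁ + i₁ * c₁ := by rw [hc]
      _ = i₁ * (1 + c₁) := by noncomm_ring
  -- insert the two unit factors `(1 - c₂) i₂ = 1` and `i₁ (1 - c₁) = 1`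
  have e₂ : i₁ * (1 + c₁) = i₁ * (1 + c₁) * ((1 - c₂) * i₂) := by rw [h₂, mul_one]
  have e₃ : (1 + c₂) * i₂ = i₁ * (1 - c₁) * ((1 + c₂) * i₂) := by rw [h₁', one_mul]
  calc (1 + c₁) * i₁ + (1 + c₂) * i₂
      = i₁ * (1 + c₁) * ((1 - c₂) * i₂) + i₁ * (1 - c₁) * ((1 + c₂) * i₂) := by rw [e₁, ← e₂, ← e₃]
    _ = i₁ * ((1 + c₁) * (1 - c₂) + (1 - c₁) * (1 + c₂)) * i₂ := by noncomm_ring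
    _ = i₁ * (2 * (1 - c₁ * c₂)) * i₂ := by rw [cayley_numerator]
    _ = 2 * (i₁ * (1 - c₁ * c₂) * i₂) := by noncomm_ring

/-! ### §2 The LU step (b02.18 (P4)) -/

/-- **LU step of the tridiagonal fatgraph Gram matrix** (b02.18 (P4)): for `Q, x, y` in any ring and `i` a two-sided
inverse of `1 - x`,
`(1 - Q x) · i · (1 - x y) - (1 - Q) · x · i · (1 - y) = 1 - Q x y`.
(With `Q = c₁⋯c_a`, `x = c_{a+1}`, `y = c_{a+2}` this is the induction step
`d_{a+1} = 2 (1 - P_{a+1})⁻¹ (1 - P_{a+2}) (1 - c_{a+2})⁻¹` for the pivots of the Gram matrix.) -/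
theorem lu_step (Q x y i : R) (h : (1 - x) * i = 1) (h' : i * (1 - x) = 1) :
    (1 - Q * x) * i * (1 - x * y) - (1 - Q) * x * i * (1 - y) = 1 - Q * x * y := by
  have hc : x * i = i * x := comm_inv_oneSub h h'
  have A : (1 - Q * x) * i * (1 - x * y) = (1 - Q) * i * (1 - x * y) + Q * (1 - x * y) := by
    calc (1 - Q * x) * i * (1 - x * y)
        = (1 - Q) * i * (1 - x * y) + Q * ((1 - x) * i) * (1 - x * y) := by noncomm_ring
      _ = (1 - Q) * i * (1 - x * y) + Q * (1 - x * y) := by rw [h]; noncomm_ring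
  have B : (1 - Q) * x * i * (1 - y) = (1 - Q) * i * (x - x * y) := by
    calc (1 - Q) * x * i * (1 - y) = (1 - Q) * (x * i) * (1 - y) := by noncomm_ring
      _ = (1 - Q) * (i * x) * (1 - y) := by rw [hc]
      _ = (1 - Q) * i * (x - x * y) := by noncomm_ring
  calc (1 - Q * x) * i * (1 - x * y) - (1 - Q) * x * i * (1 - y)
      = (1 - Q) * i * (1 - x * y) + Q * (1 - x * y) - (1 - Q) * i * (x - x * y) := by rw [A, B]
    _ = (1 - Q) * (i * (1 - x)) + Q * (1 - x * y) := by noncomm_ring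
    _ = 1 - Q * x * y := by rw [h']; noncomm_ring

/-- The telescoping form of the LU step: `(1 - P₁) · d · (1 - y) = 2 (1 - P₂)` with `P₁ = Q x`, `P₂ = Q x y`, when
`d = 2 [ (1 - x)⁻¹(1 - x y)(1 - y)⁻¹ - (1 - P₁)⁻¹ (1 - Q) x (1 - x)⁻¹ ]` is multiplied out — stated as the identity
obtained from `lu_step` by doubling (the factor `2` of the Cayley pivots). -/
theorem lu_step_two (Q x y i : R) (h : (1 - x) * i = 1) (h' : i * (1 - x) = 1) :
    2 * ((1 - Q * x) * i * (1 - x * y)) - 2 * ((1 - Q) * x * i * (1 - y)) = 2 * (1 - Q * x * y) := by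
  rw [← lu_step Q x y i h h']; noncomm_ring

end NonCommutative

/-! ### §3 Label arithmetic of the per-class weights `2 - Trd c` (b02.18 (U4)) -/

section Labels

variable {K : Type*} [CommRing K]

/-- `2O`, `F = ℚ(√2)`: the two order-8 classes have weights `2 ∓ √2` with product `2 = (√2)²` — same class modulo
squares, opposite «sign bit» (b05.17's pair `(8, 8′)`). -/
theorem weight_c8_pair (s : K) (hs : s ^ 2 = 2) : (2 - s) * (2 + s) = 2 := by
  linear_combination (-1 : K) * hs

/-- `2I`, `F = ℚ(φ)`, `φ² = φ + 1`: the two order-5 classes have weights `3 - φ` (trace `φ - 1`) and `2 + φ`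
(trace `-φ`) with product `5 = (√5)² = (2φ - 1)²`. -/
theorem weight_c5_pair (φ : K) (hφ : φ ^ 2 = φ + 1) : (3 - φ) * (2 + φ) = 5 := by
  linear_combination (-1 : K) * hφ

/-- `2I`: `5` is the square of `2φ - 1 = √5` when `φ² = φ + 1`. -/
theorem five_eq_sq (φ : K) (hφ : φ ^ 2 = φ + 1) : (2 * φ - 1) ^ 2 = 5 := by
  linear_combination (4 : K) * hφ

/-- `2I`: the order-10 class of trace `φ` has weight `2 - φ = (φ - 1)²`, a square (of an element of norm `-1`). -/
theorem weight_c10 (φ : K) (hφ : φ ^ 2 = φ + 1) : 2 - φ = (φ - 1) ^ 2 := by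
  linear_combination (-1 : K) * hφ

/-- `2I`: the order-10 class of trace `1 - φ` has weight `1 + φ = φ²`. -/
theorem weight_c10' (φ : K) (hφ : φ ^ 2 = φ + 1) : 2 - (1 - φ) = φ ^ 2 := by
  linear_combination (-1 : K) * hφ

/-- `Dic₅ ⊂ 2I`, the «exception» of b02.17 P.S.: the datum `(B₀, B₁, r₁, r₃)` has
`(2 - η₁)(2 - η₃) = (2 - φ)(1 + φ) = 1`, a square of the totally positive `1` — case (α). -/
theorem weight_dic5_r1_r3 (φ : K) (hφ : φ ^ 2 = φ + 1) : (2 - φ) * (2 - (1 - φ)) = 1 := by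
  linear_combination (-1 : K) * hφ

/-- Any group: `Nrd(1 - c) = 2 - Trd c` for `Nrd c = 1` — in coordinates, `(1 - a)² + q = 2 - 2a` when `a² + q = 1`
(`a` = real part, `q` = norm of the pure part). -/
theorem nrd_one_sub (a q : K) (h : a ^ 2 + q = 1) : (1 - a) ^ 2 + q = 2 - 2 * a := by
  linear_combination h

end Labels

end Summit.HodgeConjecture.HodgeConjecture.Ring2.WeilCoverage.UniformDiscriminant
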